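import Mathlib.Analysis.Normed.Module.FiniteDimension
import Mathlib.Topology.Algebra.Module.ModuleTopology
import Mathlib.Topology.MetricSpace.ProperSpace
import Literature.NumberTheory.Kottwitz1992.InvolutionsLemma26bHolds
import Literature.NumberTheory.Kottwitz1992.InvolutionsLemma27Holds
import HarnessLib

/-!
# [Kottwitz1992, Lemma 2.8 p. 381] The cone `B₊` of positive symmetric elements — DISCHARGED:
# `Kottwitz1992_2_8_posElts_cone_transitive_holds`

Kernel-lane companion of the statement carpet ★ `Literature/NumberTheory/Kottwitz1992/Involutions.lean` (squad TK; builds on ★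
`InvolutionsLemma26bHolds` (Lemma 2.6 (2)) and ★ `InvolutionsLemma27Holds` (Lemma 2.7 and the remark on the forms `(x, y)_b`)):
the named fact ★ `Involutions.Kottwitz1992_2_8_posElts_cone_transitive` — «Suppose that `*` is a positive involution of `B`.  Then
`B₊` is a nonempty open convex cone in `B_sym`.  Moreover the group `B^×` acts transitively on `B₊`, the action of `b ∈ B^×` on `x ∈ B₊`
being given by `x ↦ b x b*`.  Finally, the set `B₊` is equal to `{b b* | b ∈ B^×}`» — is PROVED here as
`theorem Kottwitz1992_2_8_posElts_cone_transitive_holds : Kottwitz1992_2_8_posElts_cone_transitive B ι`.  THEOREMS ONLY (no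
definition, no named fact, no `sorry`, no instance, no notation); cell hodgecm-mathlib, seat B-typ04 (g30); net debt −1.

R. E. Kottwitz, *Points on some Shimura varieties over finite fields*, J. Amer. Math. Soc. 5 (1992), Lemma 2.8 p. 381, proof p. 381
L41–L46 (held `paper:doi-10-2307-2152772`, p0009).  THE PRINTED PROOF: «The set of positive definite Hermitian forms on `B` is an open
convex cone in the vector space of Hermitian forms on `B`.  This implies the corresponding statement for `B₊`.  The transitivity of the
action of `B^×` follows from the second part of Lemma 2.6.  The last statement follows from this transitivity and the fact that `1 ∈ B₊`
(by the third part of Lemma 2.2).»  Followed here step by step, in the tree's currency (`(x, y)_b` = ★ `trForm ι b x y = tr_{B/ℝ}(x b y*)`,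
`B₊` = ★ `posElts ι`, `x ↦ b x b*` = ★ `unitsAct ι b`, `B_sym` = ★ `symSubmodule ι`, the standing hypothesis ★ `IsAlgebraWithInvolution`,
positivity ★ `IsPositiveInvolution` = condition (3) of Lemma 2.2):
* §1 the index calculus of the forms `(x, y)_b` (additive and homogeneous in `b`; `(x, y)_{c b c*} = (x c, y c)_b`), whence: `1 ∈ B₊`
  («by the third part of Lemma 2.2», i.e. `(x, x)_1 = tr(x x*) > 0`), `b b* ∈ B₊` and `c B₊ c* ⊆ B₊` for `b, c ∈ B^×`, and `B₊` is a convex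
  cone (the printed «open convex cone … implies the corresponding statement for `B₊`», minus openness);
* §2 «follows from the second part of Lemma 2.6»: for `x ∈ B₊` the forms `(u, v)_x` and `(u, v)_1` are positive definite Hermitian forms on
  the left `B`-module `B` (Hermitian symmetry is the remark after Lemma 2.7, ★ `Kottwitz1992_2_trForm_symm_alt_nondegenerate_holds`;
  `(b u, v)_x = (u, b* v)_x` is `tr(yz) = tr(zy)`), so by ★ `Kottwitz1992_2_6_2_iso_iff_holds` there is a `B`-linear automorphism `e` of `B`
  with `(e u, e v)_1 = (u, v)_x`; `e` is right multiplication by the unit `c = e(1)`, so `(u, v)_x = (u c, v c)_1 = (u, v)_{c c*}` and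
  `x = c c*` by the nondegeneracy of `(u, v)_1` (same ★ remark) — this is `B₊ ⊆ {b b* | b ∈ B^×}`, and with §1 the printed equality and the
  transitivity (`d d* = (d c⁻¹)(c c*)(d c⁻¹)*`);
* §3 openness of `B₊` in `B_sym` for the module topology of the finite-dimensional `B` (the printed «open … cone»): `(u, u)_b` is jointly
  continuous in `(b, u)` (multiplication on `B` is continuous, Mathlib `IsModuleTopology.isTopologicalRing`; linear maps out of `B` are
  continuous, `IsModuleTopology.continuous_of_linearMap`), the image `K` of the unit sphere of `ℝⁿ ≅ B` is a compact set of non-zero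
  vectors meeting every punctured line, and `{b | (k, k)_b > 0 ∀ k ∈ K}` is open by the tube lemma (Mathlib
  `IsCompact.eventually_forall_of_forall_eventually`); it equals `{b | (u, u)_b > 0 ∀ u ≠ 0}` by homogeneity, and `B₊` is its trace on
  `B_sym`;
* §4 the discharge, assembling the seven clauses of the typed letter.
HONEST LABEL: HC_CM is proved only modulo the 7 printed citations (2 remaining: hLiu418, h413) until rung 0 closes; this file adds no citation
debt (0 facts, 0 sorry) and discharges 1 named fact of ★ `Involutions`.

## References
* [Kottwitz1992] R. E. Kottwitz, Points on some Shimura varieties over finite fields, J. Amer. Math. Soc. 5 (1992) 373–444, Lemma 2.8 and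
  its proof, p. 381; Lemma 2.6 (2) p. 380; Lemma 2.7 and the Notation/remark following it, p. 381; Lemma 2.2 (3) p. 379.
-/

noncomputable section

namespace Literature.NumberTheory.Kottwitz1992.Involutions

open Literature.NumberTheory.Automorphic (leftMulTrace leftMulTrace_apply)

universe u

/-! ## §1 The index calculus of the forms `(x, y)_b` and the elementary properties of `B₊` -/

section IndexCalculus

variable {B : Type u} [Ring B] [Algebra ℝ B] {ι : B →ₗ[ℝ] B}

/-- An involution fixes `1`: `1* = 1` (`(1* · 1)* = 1* · 1**`). [cite: Kottwitz1992, §1 (p. 378)] -/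
private theorem invol_map_one (hι : IsInvolution ℝ B ι) : ι 1 = 1 := by
  have h : ι (ι 1 * 1) = ι 1 * ι (ι 1) := hι.map_mul (ι 1) 1
  rw [mul_one, hι.apply_apply, mul_one] at h
  exact h.symm

/-- `tr_{B/ℝ}(x y) = tr_{B/ℝ}(y x)` (`L_{xy} = L_x L_y` and `tr(fg) = tr(gf)`). [folklore] -/
private theorem lmTrace_comm (x y : B) : leftMulTrace ℝ B (x * y) = leftMulTrace ℝ B (y * x) := by
  rw [leftMulTrace_apply, leftMulTrace_apply, map_mul (Algebra.lmul ℝ B), map_mul (Algebra.lmul ℝ B),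
    LinearMap.trace_mul_comm]

variable (ι) in
/-- `(x, y)_b` is additive in the index `b`. [cite: Kottwitz1992, §2 Notation (p. 381)] -/
private theorem trForm_add_index (b b' x y : B) : trForm ι (b + b') x y = trForm ι b x y + trForm ι b' x y := by
  unfold trForm
  rw [mul_add, add_mul, map_add]

variable (ι) in
/-- `(x, y)_b` is additive in the index `b` (subtractive form). [cite: Kottwitz1992, §2 Notation (p. 381)] -/
private theorem trForm_sub_index (b b' x y : B) : trForm ι (b - b') x y = trForm ι b x y - trForm ι b' x y := by
  unfold trForm
  rw [mul_sub, sub_mul, map_sub]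

variable (ι) in
/-- `(x, y)_b` is `ℝ`-homogeneous in the index `b`. [cite: Kottwitz1992, §2 Notation (p. 381)] -/
private theorem trForm_smul_index (t : ℝ) (b x y : B) : trForm ι (t • b) x y = t * trForm ι b x y := by
  unfold trForm
  rw [mul_smul_comm, smul_mul_assoc, map_smul, smul_eq_mul]

/-- `(x, y)_{c b c*} = (x c, y c)_b`. [cite: Kottwitz1992, §2 Notation (p. 381)] -/
private theorem trForm_conj (hι : IsInvolution ℝ B ι) (c b x y : B) :
    trForm ι (c * b * ι c) x y = trForm ι b (x * c) (y * c) := by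
  unfold trForm
  rw [hι.map_mul]
  simp only [mul_assoc]

variable (ι) in
/-- `(t u, t u)_b = t² (u, u)_b`. [cite: Kottwitz1992, §2 Notation (p. 381)] -/
private theorem trForm_smul_smul (b : B) (t : ℝ) (u : B) : trForm ι b (t • u) (t • u) = t * t * trForm ι b u u := by
  unfold trForm
  simp only [map_smul, smul_mul_assoc, mul_smul_comm, smul_eq_mul]
  ring

/-- `c B₊ c* ⊆ B₊` for `c ∈ B^×`: `(c b c*)* = c b* c*` and `(u, u)_{c b c*} = (u c, u c)_b`.  This is the clause «the action of
`b ∈ B^×` on `x ∈ B₊` being given by `x ↦ b x b*`» (the action preserves `B₊`). [cite: Kottwitz1992, Lemma 2.8 (p. 381)] -/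
private theorem conj_mem_posElts (hι : IsInvolution ℝ B ι) {b : B} (hb : b ∈ posElts ι) (c : Bˣ) :
    (c : B) * b * ι c ∈ posElts ι := by
  refine ⟨?_, fun u hu => ?_⟩
  · rw [hι.map_mul, hι.map_mul, hι.apply_apply, hb.1, mul_assoc]
  · rw [trForm_conj hι]
    exact hb.2 (u * c) fun h => hu (by simpa using congrArg (· * ((c⁻¹ : Bˣ) : B)) h)

/-- `1 ∈ B₊` «by the third part of Lemma 2.2»: `1* = 1` and `(u, u)_1 = tr_{B/ℝ}(u u*) > 0` for `u ≠ 0`, which is the positivity of `*`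
(condition (3) of Lemma 2.2, the tree's definition ★ `IsPositiveInvolution`). [cite: Kottwitz1992, Lemma 2.8 (p. 381)] -/
private theorem one_mem_posElts (hpos : IsPositiveInvolution B ι) : (1 : B) ∈ posElts ι :=
  ⟨invol_map_one hpos.toIsInvolution, fun u hu => by
    show 0 < leftMulTrace ℝ B (u * 1 * ι u)
    rw [mul_one]
    exact hpos.trace_mul_self_pos u hu⟩

/-- `b b* ∈ B₊` for `b ∈ B^×` (`= b · 1 · b*`). [cite: Kottwitz1992, Lemma 2.8 (p. 381)] -/
private theorem mul_invol_mem_posElts (hpos : IsPositiveInvolution B ι) (b : Bˣ) : (b : B) * ι b ∈ posElts ι := by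
  have h := conj_mem_posElts hpos.toIsInvolution (one_mem_posElts hpos) b
  rwa [mul_one] at h

/-- `(d c⁻¹) (c c*) (d c⁻¹)* = d d*`: the action of `B^×` moves `c c*` to `d d*`. [cite: Kottwitz1992, Lemma 2.8 (p. 381)] -/
private theorem unitsAct_mul_invol (hι : IsInvolution ℝ B ι) (c d : Bˣ) :
    unitsAct ι (d * c⁻¹) ((c : B) * ι c) = (d : B) * ι d := by
  unfold unitsAct
  rw [Units.val_mul, hι.map_mul]
  have h1 : ι (c : B) * ι ((c⁻¹ : Bˣ) : B) = 1 := by rw [← hι.map_mul, Units.inv_mul, invol_map_one hι]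
  calc (d : B) * ((c⁻¹ : Bˣ) : B) * ((c : B) * ι c) * (ι ((c⁻¹ : Bˣ) : B) * ι d)
      = (d : B) * (((c⁻¹ : Bˣ) : B) * (c : B)) * (ι (c : B) * ι ((c⁻¹ : Bˣ) : B)) * ι d := by simp only [mul_assoc]
    _ = (d : B) * ι d := by rw [Units.inv_mul, h1, mul_one, mul_one]

variable (ι) in
/-- `B₊` is convex: `(u, u)_{s b + t b′} = s (u, u)_b + t (u, u)_{b′}` and `(s b + t b′)* = s b* + t b′*`.
[cite: Kottwitz1992, Lemma 2.8 (p. 381)] -/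
private theorem convex_posElts : Convex ℝ (posElts ι) := by
  intro b hb b' hb' s t hs ht hst
  refine ⟨?_, fun u hu => ?_⟩
  · rw [map_add, map_smul, map_smul, hb.1, hb'.1]
  · rw [trForm_add_index, trForm_smul_index, trForm_smul_index]
    have h1 := hb.2 u hu
    have h2 := hb'.2 u hu
    rcases hs.eq_or_lt with hs0 | hs0
    · rw [← hs0, zero_add] at hst
      rw [← hs0, hst, zero_mul, zero_add, one_mul]
      exact h2
    · have h3 : 0 < s * trForm ι b u u := mul_pos hs0 h1
      have h4 : 0 ≤ t * trForm ι b' u u := mul_nonneg ht h2.le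
      linarith

/-- `B₊` is a cone: `t B₊ ⊆ B₊` for `t > 0`. [cite: Kottwitz1992, Lemma 2.8 (p. 381)] -/
private theorem smul_mem_posElts {t : ℝ} (ht : 0 < t) {b : B} (hb : b ∈ posElts ι) : t • b ∈ posElts ι :=
  ⟨by rw [map_smul, hb.1], fun u hu => by rw [trForm_smul_index]; exact mul_pos ht (hb.2 u hu)⟩

end IndexCalculus

/-! ## §2 «The transitivity … follows from the second part of Lemma 2.6»: `B₊ ⊆ {c c* | c ∈ B^×}` -/

section Transitivity

variable {B : Type u} [Ring B] [Algebra ℝ B] {ι : B →ₗ[ℝ] B}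

variable (ι) in
/-- The form `(x, y)_b` on `B` as a Mathlib bilinear form (existence only; the file declares no definition). [cite: Kottwitz1992, §2 Notation (p. 381)] -/
private theorem exists_bilinForm_trForm (b : B) :
    ∃ φ : LinearMap.BilinForm ℝ B, ∀ x y : B, φ x y = trForm ι b x y :=
  ⟨LinearMap.mk₂ ℝ (fun x y => trForm ι b x y)
      (fun x x' y => by simp only [trForm, add_mul, map_add])
      (fun t x y => by simp only [trForm, smul_mul_assoc, map_smul, smul_eq_mul])
      (fun x y y' => by simp only [trForm, map_add, mul_add])
      (fun t x y => by simp only [trForm, map_smul, mul_smul_comm, smul_eq_mul]),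
    fun _ _ => rfl⟩

/-- For `b ∈ B_sym`, `(x, y)_b` is a Hermitian form on the left `B`-module `B`: symmetric by the remark after Lemma 2.7
(★ `Kottwitz1992_2_trForm_symm_alt_nondegenerate_holds`), and `(c x, y)_b = tr(c x b y*) = tr(x b y* c) = (x, c* y)_b`.
[cite: Kottwitz1992, §2 (p. 381)] -/
private theorem isHermitianForm_trForm (hB : IsAlgebraWithInvolution B ι) {b : B} (hb : ι b = b)
    {φ : LinearMap.BilinForm ℝ B} (hφ : ∀ x y : B, φ x y = trForm ι b x y) : IsHermitianForm B B ι φ := by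
  have hι : IsInvolution ℝ B ι := hB.isInvolution
  refine ⟨fun x y => ?_, fun c x y => ?_⟩
  · rw [hφ, hφ]
    exact ((Kottwitz1992_2_trForm_symm_alt_nondegenerate_holds B ι hB b).1.mpr hb) x y
  · rw [hφ, hφ, smul_eq_mul, smul_eq_mul]
    unfold trForm
    rw [hι.map_mul, hι.apply_apply, ← mul_assoc, lmTrace_comm (x * b * ι y) c]
    simp only [mul_assoc]

/-- For `b ∈ B₊`, `(x, y)_b` is a positive definite Hermitian form on the `B`-module `B`. [cite: Kottwitz1992, §2 Definition (p. 381)] -/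
private theorem isPosDefHermitianForm_trForm (hB : IsAlgebraWithInvolution B ι) {b : B} (hb : b ∈ posElts ι)
    {φ : LinearMap.BilinForm ℝ B} (hφ : ∀ x y : B, φ x y = trForm ι b x y) : IsPosDefHermitianForm B B ι φ :=
  ⟨isHermitianForm_trForm hB hb.1 hφ, fun v hv => by rw [hφ]; exact hb.2 v hv⟩

/-- **The heart of Lemma 2.8**, `B₊ ⊆ {c c* | c ∈ B^×}`: for `x ∈ B₊` the positive definite Hermitian `B`-modules `(B, (u, v)_x)` and
`(B, (u, v)_1)` have the same underlying module, so by Lemma 2.6 (2) (★ `Kottwitz1992_2_6_2_iso_iff_holds`) there is a `B`-linear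
automorphism `e` of `B` with `(e u, e v)_1 = (u, v)_x`; `e` is right multiplication by the unit `c = e(1)`, so `(u, v)_x = (u c, v c)_1 =
(u, v)_{c c*}`, and `x = c c*` by the nondegeneracy of `(u, v)_1`. [cite: Kottwitz1992, Lemma 2.8 (p. 381)] -/
private theorem exists_units_eq_mul_invol (hB : IsAlgebraWithInvolution B ι) (hpos : IsPositiveInvolution B ι) {x : B}
    (hx : x ∈ posElts ι) : ∃ c : Bˣ, x = (c : B) * ι c := by
  have hι : IsInvolution ℝ B ι := hB.isInvolution
  obtain ⟨φx, hφx⟩ := exists_bilinForm_trForm ι x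
  obtain ⟨φ1, hφ1⟩ := exists_bilinForm_trForm ι (1 : B)
  have hxP : IsPosDefHermitianForm B B ι φx := isPosDefHermitianForm_trForm hB hx hφx
  have h1P : IsPosDefHermitianForm B B ι φ1 := isPosDefHermitianForm_trForm hB (one_mem_posElts hpos) hφ1
  obtain ⟨e, he⟩ :=
    (Kottwitz1992_2_6_2_iso_iff_holds ι hB hpos B B φx φ1 hxP h1P).mpr ⟨LinearEquiv.refl B B⟩
  -- `e` is right multiplication by `c = e 1`
  have hec : ∀ v : B, e v = v * e 1 := fun v => by
    have h := e.map_smul v (1 : B)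
    rwa [smul_eq_mul, mul_one, smul_eq_mul] at h
  -- `c` is a unit, with inverse `e⁻¹ 1`
  have hdc : e.symm 1 * e 1 = 1 := by rw [← hec, LinearEquiv.apply_symm_apply]
  have hcd : e 1 * e.symm 1 = 1 :=
    e.injective (by rw [hec (e 1 * e.symm 1), mul_assoc, hdc, mul_one])
  refine ⟨⟨e 1, e.symm 1, hcd, hdc⟩, ?_⟩
  show x = e 1 * ι (e 1)
  -- `(v, w)_x = (v, w)_{c c*}` for all `v, w`
  have hforms : ∀ v w : B, trForm ι (x - e 1 * ι (e 1)) v w = 0 := fun v w => by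
    rw [trForm_sub_index, sub_eq_zero, ← hφx v w, ← he v w, hφ1, hec v, hec w, ← trForm_conj hι (e 1) 1 v w, mul_one]
  -- nondegeneracy of `(v, w)_1` (the remark after Lemma 2.7, at the invertible index `1`)
  have hnd := (Kottwitz1992_2_trForm_symm_alt_nondegenerate_holds B ι hB 1).2.2.mpr isUnit_one (x - e 1 * ι (e 1))
    fun y => by
      have h := hforms 1 y
      unfold trForm at h ⊢
      rw [one_mul] at h
      rwa [mul_one]
  exact sub_eq_zero.mp hnd

end Transitivity

/-! ## §3 «`B₊` is … open … in `B_sym`» -/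

section Openness

variable {B : Type u} [Ring B] [Algebra ℝ B] {ι : B →ₗ[ℝ] B}

variable (ι) in
/-- The positive definite indices form an open subset of `B` (finite-dimensional, module topology): `(u, u)_b` is jointly continuous in
`(b, u)`, the image `K` of the unit sphere of `ℝⁿ ≅ B` is a compact set of non-zero vectors meeting every punctured line through `0`, so
`{b | (k, k)_b > 0 ∀ k ∈ K}` is open by the tube lemma and equals `{b | (u, u)_b > 0 ∀ u ≠ 0}` by homogeneity.  (The printed «the set of
positive definite Hermitian forms on `B` is an open … cone».) [cite: Kottwitz1992, Lemma 2.8 (p. 381)] -/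
private theorem isOpen_setOf_posDef [FiniteDimensional ℝ B] [TopologicalSpace B] [IsModuleTopology ℝ B] :
    IsOpen {b : B | ∀ u : B, u ≠ 0 → 0 < trForm ι b u u} := by
  haveI : ContinuousAdd B := IsModuleTopology.toContinuousAdd ℝ B
  haveI : IsTopologicalRing B := IsModuleTopology.isTopologicalRing ℝ B
  -- joint continuity of `q (b, u) = (u, u)_b = tr(u b u*)`
  have hιc : Continuous ι := IsModuleTopology.continuous_of_linearMap ι
  have htr : Continuous (leftMulTrace ℝ B) := IsModuleTopology.continuous_of_linearMap _
  have hq : Continuous fun p : B × B => trForm ι p.1 p.2 p.2 := by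
    unfold trForm
    exact htr.comp ((continuous_snd.mul continuous_fst).mul (hιc.comp continuous_snd))
  -- the compact set `K`: image of the unit sphere of `ℝⁿ` under a linear isomorphism `f : ℝⁿ ≅ B`
  obtain ⟨f⟩ : Nonempty ((Fin (Module.finrank ℝ B) → ℝ) ≃ₗ[ℝ] B) := ⟨(Module.finBasis ℝ B).equivFun.symm⟩
  have hf : Continuous f := IsModuleTopology.continuous_of_linearMap f.toLinearMap
  have hK : IsCompact (f '' Metric.sphere (0 : Fin (Module.finrank ℝ B) → ℝ) 1) := (isCompact_sphere _ _).image hf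
  have hK0 : ∀ k ∈ f '' Metric.sphere (0 : Fin (Module.finrank ℝ B) → ℝ) 1, k ≠ 0 := by
    rintro _ ⟨w, hw, rfl⟩ h
    rw [f.map_eq_zero_iff] at h
    rw [h, mem_sphere_zero_iff_norm, norm_zero] at hw
    exact zero_ne_one hw
  have hKray : ∀ u : B, u ≠ 0 → ∃ k ∈ f '' Metric.sphere (0 : Fin (Module.finrank ℝ B) → ℝ) 1, ∃ t : ℝ, t ≠ 0 ∧ u = t • k := by
    intro u hu
    have hw : f.symm u ≠ 0 := f.symm.map_ne_zero_iff.mpr hu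
    have hn : ‖f.symm u‖ ≠ 0 := norm_ne_zero_iff.mpr hw
    refine ⟨f (‖f.symm u‖⁻¹ • f.symm u), ⟨_, ?_, rfl⟩, ‖f.symm u‖, hn, ?_⟩
    · rw [mem_sphere_zero_iff_norm, norm_smul, norm_inv, norm_norm, inv_mul_cancel₀ hn]
    · rw [map_smul, smul_smul, mul_inv_cancel₀ hn, one_smul, LinearEquiv.apply_symm_apply]
  -- the tube lemma
  rw [isOpen_iff_mem_nhds]
  intro b hb
  have hb' : ∀ u : B, u ≠ 0 → 0 < trForm ι b u u := hb
  have hev : ∀ k ∈ f '' Metric.sphere (0 : Fin (Module.finrank ℝ B) → ℝ) 1,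
      ∀ᶠ z : B × B in nhds (b, k), 0 < trForm ι z.1 z.2 z.2 := fun k hk =>
    (isOpen_lt continuous_const hq).mem_nhds (hb' k (hK0 k hk))
  refine Filter.mem_of_superset
    (hK.eventually_forall_of_forall_eventually (P := fun b' k => 0 < trForm ι b' k k) hev) fun b₁ hb₁ u hu => ?_
  have hb₁' : ∀ k ∈ f '' Metric.sphere (0 : Fin (Module.finrank ℝ B) → ℝ) 1, 0 < trForm ι b₁ k k := hb₁
  obtain ⟨k, hk, t, ht, rfl⟩ := hKray u hu
  rw [trForm_smul_smul]
  exact mul_pos (mul_self_pos.mpr ht) (hb₁' k hk)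

variable (ι) in
/-- «`B₊` is … open … in `B_sym`»: `B₊` is the trace on `B_sym` of the open set of positive definite indices.
[cite: Kottwitz1992, Lemma 2.8 (p. 381)] -/
private theorem isOpen_posElts_sym [FiniteDimensional ℝ B] [TopologicalSpace B] [IsModuleTopology ℝ B] :
    IsOpen {x : symSubmodule ι | (x : B) ∈ posElts ι} := by
  have hset : {x : symSubmodule ι | (x : B) ∈ posElts ι} =
      Subtype.val ⁻¹' {b : B | ∀ u : B, u ≠ 0 → 0 < trForm ι b u u} := by
    ext x
    have hx : ι (x : B) = x := by
      have h := x.2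
      simp only [symSubmodule, LinearMap.mem_eqLocus] at h
      exact h
    simp only [Set.mem_setOf_eq, Set.mem_preimage, posElts]
    exact ⟨fun h => h.2, fun h => ⟨hx, h⟩⟩
  rw [hset]
  exact (isOpen_setOf_posDef ι).preimage continuous_subtype_val

end Openness

/-! ## §4 Lemma 2.8 -/

section LemmaTwoEight

variable (B : Type u) [Ring B] [Algebra ℝ B] (ι : B →ₗ[ℝ] B)

/-- **Lemma 2.8, PROVED**: ★ `Kottwitz1992_2_8_posElts_cone_transitive` holds — for a finite-dimensional semisimple `ℝ`-algebra with
positive involution, «`B₊` is a nonempty open convex cone in `B_sym`.  Moreover the group `B^×` acts transitively on `B₊`, the action of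
`b ∈ B^×` on `x ∈ B₊` being given by `x ↦ b x b*`.  Finally, the set `B₊` is equal to `{b b* | b ∈ B^×}`»: `1 ∈ B₊` (Lemma 2.2 (3));
convex cone by the index calculus; open by continuity and compactness (§3); `B₊ = {b b*}` by Lemma 2.6 (2) applied to `(B, (,)_x)` and
`(B, (,)_1)` (§2); transitivity and invariance from it. [cite: Kottwitz1992, Lemma 2.8 (p. 381)] -/
theorem Kottwitz1992_2_8_posElts_cone_transitive_holds : Kottwitz1992_2_8_posElts_cone_transitive B ι := by
  intro hB hpos
  haveI : FiniteDimensional ℝ B := hB.finiteDimensional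
  have hι : IsInvolution ℝ B ι := hpos.toIsInvolution
  have hsq : posElts ι = {x | ∃ b : Bˣ, x = (b : B) * ι b} :=
    Set.eq_of_subset_of_subset (fun x hx => exists_units_eq_mul_invol hB hpos hx)
      (by rintro _ ⟨b, rfl⟩; exact mul_invol_mem_posElts hpos b)
  refine ⟨⟨1, one_mem_posElts hpos⟩, ?_, convex_posElts ι, fun t x ht hx => smul_mem_posElts ht hx,
    fun b x hx => conj_mem_posElts hι hx b, fun x hx y hy => ?_, hsq⟩
  · intro _ _
    exact isOpen_posElts_sym ι
  · obtain ⟨c, rfl⟩ := exists_units_eq_mul_invol hB hpos hx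
    obtain ⟨d, rfl⟩ := exists_units_eq_mul_invol hB hpos hy
    exact ⟨d * c⁻¹, unitsAct_mul_invol hι c d⟩

end LemmaTwoEight

end Literature.NumberTheory.Kottwitz1992.Involutions

end
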